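/-
Copyright (c) 2026 the pub-hodgecm-mathlib formalisation cell (harness21).  Prover seat hodgecm-mathlib-K2E1-p10 (g5), Track B «K2-LIT», h413 = `stmt-HodgeConjecture-24833`,
R90-TF section S8 «ContSpec-n½», the hCONT letter of the (R)′ ∕ (V) roads (S8 dealer R90-CS-plan (g3), S8-R166 (2) ∕ S8-R171; census `K2/K2E1-p10/g5/CENSUS-hCONT.K2E1-p10-g5.md` +
ROAD CORRECTION 00:46:55Z «operator road»): the GENERIC-EIGENVALUE EDITION of ★ CLOSER₃ `K2E1MaassSelbergFamilyCMThree.exists_truncatedFamily_cm_three` (K2E1-p11 (g2), «MS-3») —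
the `L²(𝔛, μ)`-holomorphic family of truncated continued Eisenstein classes on the per-ball holomorphy set `U ∖ P`, for ANY section whose Bernstein–Lapid ball data carry abstract entire
eigenvalue functions `ŝ_i` (the χ-pair letters `hCD` of ★ row 6 EIGEN `chiEisenstein_meromorphic_exports_cm_three_of_letters_of_eigen`) — PURE ASSEMBLY, bytes of ★ CLOSER₃ with
`∫ h_j·H^z dν_G ↦ ŝ_j z`.
-/
import Summits.HodgeConjecture.HodgeConjecture.Theorems.K2E1MaassSelbergFamilyCMThree   -- ★ CLOSER₃ (K2E1-p11 g2): brings ★ X1₃, ★ `exists_family_of_operator_letters_three'`, ★ (O2c) `exists_highPartOperator_three`, ★ `hid_of_unfolding`, ★ `exists_lowPart_clm`, ★ `shiftBound_of_isCompact`, ★ `hK1_cm_three_of`, ★ `iotaBound_cm_three`, ★ the within-glue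
import HarnessLib

/-!
# h413 ∕ R90-TF S8 — `K2E1ChiTruncatedFamilyCMThree`: THE `L²(𝔛, μ)`-HOLOMORPHIC FAMILY `z ↦ [Λ^{T₀} Ẽ(z)]` OF A CONTINUED EISENSTEIN FAMILY OF `U(2,1)_{L∕L⁺}` ON THE PER-BALL
# HOLOMORPHY SET `U ∖ P` — ★ CLOSER₃ IN THE GENERIC-EIGENVALUE CURRENCY (the operator road; no cusp-decay letter, no pointwise majorant)

Track B ∕ K2-LIT, crux h413 = `stmt-HodgeConjecture-24833`, route of record `HCCMUnconditional`; cell `hodgecm-mathlib`, R90-TF section S8 «ContSpec-n½» — the hCONT letter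
(«the bare `L²`-continuation of the truncated family below `Re z = 2`») shared by the (R)′ road (K2E1-p12's ★ ℓ-ROAD `res_midBlock_le_residual_of_letters'''`, binder `hCONT`) and the
(V) road (★ p863385 `resGMidBlock_ne_bot_assembly`, rows (i′) `Fam hFd hFam`).  Prover seat `hodgecm-mathlib-K2E1-p10` (g5).  THEOREMS ONLY (no `def`, no `instance`, no notation, no
named-fact hypothesis, no `sorry`; default heartbeats); lane `--supports stmt-HodgeConjecture-24833 --as helper` (count-neutral).  CLOSES NO SOCKET.

THE MATHEMATICS [BernsteinLapid2019, Thm 2.3, §4 Claims 4–5 (p. 10); MoeglinWaldspurger1995, I.2.13, IV.2.3].  ★ CLOSER₃ assembles, for the SPHERICAL continued series, the class of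
`Λ^{T₀} Ẽ(z)` in `L²(𝔛, μ)` as `ĥ_j(z)⁻¹ • (A_{T₀} (T_j (vX z)) + K_j (vX z))` on each patch `U ∩ {ĥ_j ≠ 0} ∖ P` — bounded operators (the low cut-off `A_{T₀}` ★ (O1), the Hecke operator
`T_j` on `𝓗_k(𝔛)`, the transported high-cusp smoothing `K_j` ★ (O2c), built from ★ K1₃-L² cusp decay `hK1_cm_three_of` and ★ `hid_of_unfolding`) applied to the holomorphic
Bernstein–Lapid vector `vX`, times the holomorphic scalar `ĥ_j⁻¹` — and glues the patches (★ `exists_differentiableOn_of_local_ae_eq_within`).  NOTHING in that assembly reads the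
section except through the per-ball BINDERS and the pointwise representation (E5) `Ẽ(z)(g) = ĥ_j(z)⁻¹·∫ h_j(y)·(vX z)[(g y)⁻¹] dν_G`; the eigenvalue enters only as a holomorphic scalar,
non-vanishing on the patch (★ `exists_family_of_operator_letters_three'` takes an abstract `ĥ`).  This file therefore prints CLOSER₃'s bytes with the spherical transform
`∫ h_j·H^z dν_G` replaced by an abstract entire `ŝ_j` — the currency of the χ-pair letters `hCD` of ★ row 6 EIGEN (`hη`, `h_i = S_{η_i} η_i`, `hκ`, `hΩ`, `hTX`, `hcov : ∀ z ∈ D_n, ∃ i,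
ŝ_i z ≠ 0`, `∀ i, Differentiable ℂ (ŝ i)`) and of the core's (E5) (★ `chiEisenstein_meromorphic_exports_core_of_packages_cm_three_of_eigen` :104) — so the `(χ₁, χ₂)`-pair family of S8's
middle-pole block gets its truncated `L²`-family on `U_n ∖ P` with every input ★.
* §1 **`exists_truncatedFamily_cm_three_of_eigen`** — `∃ T₀ ≥ 1, ∃ Fam : ℂ → Lp ℂ 2 μ, DifferentiableOn ℂ Fam (U ∖ P) ∧ ∀ z ∈ U ∖ P, ⇑(Fam z) =ᵐ[μ] quotFun (Λ^{T₀} (Ec z))`.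
* §2 **`exists_truncatedFamily_cm_three_of_eigen_on`** — the same restricted to any `D ⊆ U ∖ P` (the per-ball patch of the exports edition to come: `D = U_n ∖ P` met with a half-plane or
  a quarter-plane).
SEQUEL (hCONT road of record, bus 00:46:55Z): (C3) the truncation-LEVEL CHANGE `[Λ^{T′}Ẽ(z)] − [Λ^{T}Ẽ(z)]` is `L²`-holomorphic (so ONE `T` serves all balls); (C2) the exports edition
`…WithTruncatedFamilyCMThree` adding (E6) «`∀ T ≥ 1`, the truncated continued family is `L²`-holomorphic off `P`»; (C4) hCONT in the ℓ-ROAD's bytes modulo the pole ledger `{1<Re} ∖ Sp ⊆ Pᶜ`.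
HONEST LABEL: HC_CM is proved only modulo the 7 printed citations (2 remaining named inputs: hLiu418 = `stmt-HodgeConjecture-24832`, h413 = `stmt-HodgeConjecture-24833`) until rung 0
closes; count-neutral helper, closes no socket; letter-free except the X1_χ ∕ X2_χ binders it is fed.

## References
* [BernsteinLapid2019] J. Bernstein, E. Lapid, *On the meromorphic continuation of Eisenstein series*, J. AMS 37 (2024) (arXiv:1911.02342), Thm 2.3, §4 Claims 4–5 (p. 10).
* [MoeglinWaldspurger1995] C. Mœglin, J.-L. Waldspurger, *Spectral decomposition and Eisenstein series* (1995), I.2.13, IV.2.3, IV.3.12 (a).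
-/

set_option autoImplicit false
-- the mandated namespace repeats `HodgeConjecture.HodgeConjecture`, as in every `Theorems/*.lean` of this sub-problem
set_option linter.dupNamespace false

noncomputable section

open MeasureTheory MeasureTheory.Measure Set NumberField IsDedekindDomain Filter Topology
open scoped NNReal ENNReal ComplexConjugate
open Literature.MeasureTheory.Group Literature.NumberTheory
open Literature.NumberTheory.Automorphic Literature.NumberTheory.Automorphic.UnitaryGroup AdelicGroupData
open Summit.HodgeConjecture.HodgeConjecture.Cruxes.H413.K2E1BLBorelSpacesU2Defs
open Summit.HodgeConjecture.HodgeConjecture.Cruxes.H413.K2E1BLBorelOperatorsU2Defs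
open Summit.HodgeConjecture.HodgeConjecture.Cruxes.H413.K2E1BLIotaClosedEmbeddingU3 (iotaBound_cm_three isFiniteMeasure_weightedTruncMeasure_cm_three)
open Summit.HodgeConjecture.HodgeConjecture.Cruxes.H413.K2E1BLQuotientMeasureU (measurePreserving_rightShift_of_unfolding)
open Summit.HodgeConjecture.HodgeConjecture.Cruxes.H413.K2E1BLShiftBoundU2 (shiftBound_of_isCompact)
open Summit.HodgeConjecture.HodgeConjecture.Cruxes.H413.K2E1IntertwinedSectionInvariance (map_conj_toAdelic_eq_self_three)
open Summit.HodgeConjecture.HodgeConjecture.Cruxes.H413.K2E1MaassSelbergFamilyPayerCMTwo (exists_lowPart_clm)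
open Summit.HodgeConjecture.HodgeConjecture.Cruxes.H413.K2E1MaassSelbergFamilyPayerNaturalCMThree (exists_family_of_operator_letters_three')
open Summit.HodgeConjecture.HodgeConjecture.Cruxes.H413.K2E1BLHighPartOperatorU (exists_highPartOperator_three)
open Summit.HodgeConjecture.HodgeConjecture.Cruxes.H413.K2E1BLHighPartIdentificationU (hid_of_unfolding)
open Summit.HodgeConjecture.HodgeConjecture.Cruxes.H413.K2E1BLLiftIntegrabilityU (lift_quotientSubgroup_mul)
open Summit.HodgeConjecture.HodgeConjecture.Cruxes.H413.K2E1MaassSelbergFamilyCMTwo (exists_differentiableOn_of_local_ae_eq_within)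

namespace Summit.HodgeConjecture.HodgeConjecture.Cruxes.H413.K2E1ChiTruncatedFamilyCMThree

/-! ## §1 CLOSER₃ in ŝ-currency: the holomorphic family of truncated continued Eisenstein classes on `U ∖ P` -/

section Closer

variable (L : Type) [Field L] [NumberField L] [IsCMField L]
  [MeasurableSpace (quasiSplit (↥(maximalRealSubfield L)) L (IsCMField.complexConj L) 3).Adelic] [BorelSpace (quasiSplit (↥(maximalRealSubfield L)) L (IsCMField.complexConj L) 3).Adelic]

/-- **CLOSER₃, GENERIC-EIGENVALUE EDITION — THE `L²(𝔛, μ)`-HOLOMORPHIC FAMILY OF TRUNCATED CONTINUED EISENSTEIN CLASSES OF `U(2,1)_{L∕L⁺}` ON `U ∖ P`** (module docstring).  Structural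
letters as ★ X1 (`μ` automorphic; `ν_G` Haar, inversion-invariant, s-finite; `ν` Haar on `N(𝔸)`, right- and inversion-invariant; `𝓕` a fundamental domain of `N(F)` of compact closure and
non-zero measure; the covering weight `β`; the unfolded s-finite `μZ`); the per-ball objects and clauses as binders, with ENTIRE eigenvalue functions `ŝ_i` (`hŝ`) non-vanishing somewhere
at every point of the ball (`hcov`) and the Hecke letter `hTX`; the global continued function `Ec`, a set `P`, and the pointwise representation (E5) in ŝ-currency.  THEN
`∃ T₀ ≥ 1, ∃ Fam, DifferentiableOn ℂ Fam (U ∖ P) ∧ ∀ z ∈ U ∖ P, Fam z =ᵐ[μ] quotFun (Λ^{T₀} (Ec z))` — ★ CLOSER₃'s proof with `ĥ_j ↦ ŝ_j`.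
[cite: BernsteinLapid2019, Thm 2.3 and §4 Claims 4–5 (p. 10)] [cite: MoeglinWaldspurger1995, I.2.13, IV.2.3] -/
theorem exists_truncatedFamily_cm_three_of_eigen
    -- structural letters: the measures (as ★ X1)
    (μ : Measure (quasiSplit (↥(maximalRealSubfield L)) L (IsCMField.complexConj L) 3).automorphicQuotient) [(quasiSplit (↥(maximalRealSubfield L)) L (IsCMField.complexConj L) 3).IsAutomorphicMeasure μ]
    (νG : Measure (quasiSplit (↥(maximalRealSubfield L)) L (IsCMField.complexConj L) 3).Adelic) [νG.IsHaarMeasure] [νG.IsInvInvariant] [SFinite νG]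
    (ν : Measure ↥(adelicUnipotent (↥(maximalRealSubfield L)) L (IsCMField.complexConj L) 3)) [ν.IsHaarMeasure] [ν.IsMulRightInvariant] [ν.IsInvInvariant]
    {𝓕 : Set ↥(adelicUnipotent (↥(maximalRealSubfield L)) L (IsCMField.complexConj L) 3)}
    (h𝓕N : IsFundamentalDomain ↥(rationalUnipotent (↥(maximalRealSubfield L)) L (IsCMField.complexConj L) 3) 𝓕 ν) (h𝓕c : IsCompact (closure 𝓕)) (h𝓕₀ : ν 𝓕 ≠ 0)
    {β : (quasiSplit (↥(maximalRealSubfield L)) L (IsCMField.complexConj L) 3).Adelic → ℝ≥0∞}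
    (hβ : IsCoveringWeight ↥((arithmeticBorel (↥(maximalRealSubfield L)) L (IsCMField.complexConj L) 3).map (quasiSplit (↥(maximalRealSubfield L)) L (IsCMField.complexConj L) 3).arithmeticSubgroup.subtype) β)
    {μZ : Measure (borelQuotient (↥(maximalRealSubfield L)) L (IsCMField.complexConj L) 3)} [SFinite μZ]
    (hμZ : ∀ f : borelQuotient (↥(maximalRealSubfield L)) L (IsCMField.complexConj L) 3 → ℝ≥0∞, Measurable f → ∫⁻ z, f z ∂μZ = ∫⁻ g, β g * f (toBorelQuotient (↥(maximalRealSubfield L)) L (IsCMField.complexConj L) 3 g) ∂νG)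
    -- X1's per-ball objects (ball `D_n = ball 0 (n+2)`, weight `k = n + 4`)
    (n : ℕ) {I : Type} [Fintype I] (η : I → GL (Fin 3) (AdeleRing (𝓞 L) L) → ℝ) (h : I → (quasiSplit (↥(maximalRealSubfield L)) L (IsCMField.complexConj L) 3).Adelic → ℂ) (a : ℝ≥0) (κ : I → ℝ≥0)
    (T : I → HX (↥(maximalRealSubfield L)) L (IsCMField.complexConj L) 3 (n + 4) μ →L[ℂ] HX (↥(maximalRealSubfield L)) L (IsCMField.complexConj L) 3 (n + 4) μ) (U : Set ℂ)
    (vX : ℂ → HX (↥(maximalRealSubfield L)) L (IsCMField.complexConj L) 3 (n + 4) μ)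
    -- the EIGENVALUE FUNCTIONS `ŝ_i` (entire) replacing the spherical transforms `∫ h_i·H^z dν_G` of ★ CLOSER₃ (the χ letters `hCD` carry them)
    (ŝ : I → ℂ → ℂ) (hŝ : ∀ i, Differentiable ℂ (ŝ i))
    -- X1_χ's clauses (only those used)
    (hη : ∀ i, IsTestFunctionGL 3 L (η i))
    (hdef : ∀ i, h i = fun y : (quasiSplit (↥(maximalRealSubfield L)) L (IsCMField.complexConj L) 3).Adelic => orbitalSmoothing νG (fun x : (quasiSplit (↥(maximalRealSubfield L)) L (IsCMField.complexConj L) 3).Adelic => ((η i (adelicVal (↥(maximalRealSubfield L)) L (IsCMField.complexConj L) 3 ((StdForm.antidiagonal 3).over L) x) : ℝ) : ℂ)) (fun x : (quasiSplit (↥(maximalRealSubfield L)) L (IsCMField.complexConj L) 3).Adelic => ((η i (adelicVal (↥(maximalRealSubfield L)) L (IsCMField.complexConj L) 3 ((StdForm.antidiagonal 3).over L) x) : ℝ) : ℂ)) y)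
    (hreg : ∀ i, Continuous (h i) ∧ HasCompactSupport (h i))
    (hcov : ∀ z ∈ Metric.ball (0 : ℂ) (n + 2), ∃ i, (ŝ i z) ≠ 0)
    (ha : 0 < a) (hκ : ∀ i, 1 ≤ κ i)
    (hΩ : ∀ i, ∀ z : borelQuotient (↥(maximalRealSubfield L)) L (IsCMField.complexConj L) 3, ∀ y ∈ tsupport (h i), borelQuotHeight (↥(maximalRealSubfield L)) L (IsCMField.complexConj L) 3 z ≤ κ i * borelQuotHeight (↥(maximalRealSubfield L)) L (IsCMField.complexConj L) 3 (rightShift (↥(maximalRealSubfield L)) L (IsCMField.complexConj L) 3 y z))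
    (hTX : ∀ i, ∀ u : HX (↥(maximalRealSubfield L)) L (IsCMField.complexConj L) 3 (n + 4) μ, (T i u : (quasiSplit (↥(maximalRealSubfield L)) L (IsCMField.complexConj L) 3).automorphicQuotient → ℂ) =ᵐ[μ.withDensity fun x => (((supHeight (↥(maximalRealSubfield L)) L (IsCMField.complexConj L) 3 x)⁻¹ ^ (2 * (n + 4)) : ℝ≥0) : ℝ≥0∞)]
      fun ξ => ∫ y, h i y * (u : (quasiSplit (↥(maximalRealSubfield L)) L (IsCMField.complexConj L) 3).automorphicQuotient → ℂ) (y⁻¹ • ξ) ∂νG)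
    (hUo : IsOpen U) (hUD : U ⊆ Metric.ball (0 : ℂ) (n + 2)) (hvX : DifferentiableOn ℂ vX U)
    -- the global continued function, the exceptional set, and the pointwise representation (E5) (★ X2)
    (Ec : ℂ → (quasiSplit (↥(maximalRealSubfield L)) L (IsCMField.complexConj L) 3).Adelic → ℂ) (P : Set ℂ)
    (hE5 : ∀ j, ∀ z ∈ U, z ∉ P → (ŝ j z) ≠ 0 → ∀ g : (quasiSplit (↥(maximalRealSubfield L)) L (IsCMField.complexConj L) 3).Adelic,
      Ec z g = (ŝ j z)⁻¹ *
        ∫ y, h j y * ((vX z : HX (↥(maximalRealSubfield L)) L (IsCMField.complexConj L) 3 (n + 4) μ) : (quasiSplit (↥(maximalRealSubfield L)) L (IsCMField.complexConj L) 3).automorphicQuotient → ℂ)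
          ((quasiSplit (↥(maximalRealSubfield L)) L (IsCMField.complexConj L) 3).toAutomorphicQuotient (g * y)⁻¹) ∂νG) :
    ∃ T₀ : ℝ≥0, 1 ≤ T₀ ∧ ∃ Fam : ℂ → Lp ℂ 2 μ, DifferentiableOn ℂ Fam (U \ P) ∧
      ∀ z ∈ U \ P, ((Fam z : Lp ℂ 2 μ) : (quasiSplit (↥(maximalRealSubfield L)) L (IsCMField.complexConj L) 3).automorphicQuotient → ℂ) =ᵐ[μ]
        (quasiSplit (↥(maximalRealSubfield L)) L (IsCMField.complexConj L) 3).quotFun (truncation ν 𝓕 T₀ (Ec z)) := by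
  classical
  -- involution facts, structural consequences
  have hc : IsCMField.complexConj L * IsCMField.complexConj L = 1 :=
    AlgEquiv.ext fun x => by rw [AlgEquiv.mul_apply, AlgEquiv.one_apply, IsCMField.complexConj_apply_apply]
  have hc1 : IsCMField.complexConj L ≠ 1 := IsCMField.complexConj_ne_one L
  have h𝓕top : ν 𝓕 ≠ ∞ := ((measure_mono subset_closure).trans_lt h𝓕c.measure_lt_top).ne
  haveI : νG.IsMulRightInvariant := by rw [← Measure.inv_eq_self νG]; infer_instance
  have hright := measurePreserving_rightShift_of_unfolding νG hβ hμZ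
  letI : MeasurableSpace (AdeleRing (𝓞 L) L) := borel _
  haveI : BorelSpace (AdeleRing (𝓞 L) L) := ⟨rfl⟩
  have hconj := fun b₀ (hb₀ : b₀ ∈ borelU (IsCMField.complexConj L : L →+* L) ((StdForm.antidiagonal 3).over L)) => map_conj_toAdelic_eq_self_three hc hc1 ν hb₀
  -- the test functions: `h = S_η η`, continuity, compact support
  have hfun : h = fun i => fun y : (quasiSplit (↥(maximalRealSubfield L)) L (IsCMField.complexConj L) 3).Adelic => orbitalSmoothing νG (fun x : (quasiSplit (↥(maximalRealSubfield L)) L (IsCMField.complexConj L) 3).Adelic => ((η i (adelicVal (↥(maximalRealSubfield L)) L (IsCMField.complexConj L) 3 ((StdForm.antidiagonal 3).over L) x) : ℝ) : ℂ)) (fun x : (quasiSplit (↥(maximalRealSubfield L)) L (IsCMField.complexConj L) 3).Adelic => ((η i (adelicVal (↥(maximalRealSubfield L)) L (IsCMField.complexConj L) 3 ((StdForm.antidiagonal 3).over L) x) : ℝ) : ℂ)) y :=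
    funext hdef
  have hhc : ∀ i, Continuous (h i) := fun i => (hreg i).1
  have hhs : ∀ i, HasCompactSupport (h i) := fun i => (hreg i).2
  -- levels: the pull-back letter at `a`, the shift constants `κ'_j`, and ONE common upper level `T₀`
  have hb : IotaBound (↥(maximalRealSubfield L)) L (IsCMField.complexConj L) 3 (n + 4) a μ μZ := iotaBound_cm_three L μ νG hβ hμZ ha (n + 4)
  haveI : IsFiniteMeasure (weightedTruncMeasure (↥(maximalRealSubfield L)) L (IsCMField.complexConj L) 3 (n + 4) a μZ) := isFiniteMeasure_weightedTruncMeasure_cm_three L μ νG hβ hμZ ha (n + 4)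
  have hSB : ∀ j, ∃ κ' : ℝ≥0, 1 ≤ κ' ∧ ∀ (k : ℕ) (c₁ c₀ : ℝ≥0), κ' * c₁ ≤ c₀ →
      ∀ h' : (quasiSplit (↥(maximalRealSubfield L)) L (IsCMField.complexConj L) 3).Adelic → ℂ, Measurable h' → Integrable h' νG → (∀ y, y ∉ tsupport (h j) → h' y = 0) →
        ShiftBound (↥(maximalRealSubfield L)) L (IsCMField.complexConj L) 3 k c₁ c₀ νG μZ h' := fun j =>
    shiftBound_of_isCompact (νG := νG) (μZ := μZ) hright (hhs j).isCompact
  choose κ' hκ'1 hκ' using hSB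
  set T₀ : ℝ≥0 := max 1 (Finset.univ.sup fun j => max (κ' j) (κ j) * a) with hT₀def
  have hT₀1 : 1 ≤ T₀ := le_max_left _ _
  have hT₀pos : 0 < T₀ := lt_of_lt_of_le one_pos hT₀1
  have hκT : ∀ j, κ j * a ≤ T₀ := fun j =>
    ((mul_le_mul_of_nonneg_right (le_max_right (κ' j) (κ j)) zero_le).trans (Finset.le_sup (f := fun j => max (κ' j) (κ j) * a) (Finset.mem_univ j))).trans (le_max_right _ _)
  have hκ'T : ∀ j, κ' j * a ≤ T₀ := fun j =>
    ((mul_le_mul_of_nonneg_right (le_max_left (κ' j) (κ j)) zero_le).trans (Finset.le_sup (f := fun j => max (κ' j) (κ j) * a) (Finset.mem_univ j))).trans (le_max_right _ _)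
  haveI : IsFiniteMeasure (weightedTruncMeasure (↥(maximalRealSubfield L)) L (IsCMField.complexConj L) 3 0 T₀ μZ) := isFiniteMeasure_weightedTruncMeasure_cm_three L μ νG hβ hμZ hT₀pos 0
  -- the shift letters at `(a, T₀)`
  have hs : ∀ j, ShiftBound (↥(maximalRealSubfield L)) L (IsCMField.complexConj L) 3 (n + 4) a T₀ νG μZ (h j) := fun j =>
    hκ' j (n + 4) a T₀ (hκ'T j) (h j) (hhc j).measurable ((hhc j).integrable_of_hasCompactSupport (hhs j)) fun y hy => image_eq_zero_of_notMem_tsupport hy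
  -- K2's cusp decay at `(a, T₀)` for `h_j = S_{η_j} η_j` (★ `hK1_cm_three_of` ∘ ★ K2-defs1 (ii) ∘ ★ product formula), `m = 0`
  have hK1 : ∀ j, ∃ C : ℝ, 0 ≤ C ∧ ∀ f : HNcusp (↥(maximalRealSubfield L)) L (IsCMField.complexConj L) 3 (n + 4) a μZ,
      ∀ᵐ z ∂(weightedTruncMeasure (↥(maximalRealSubfield L)) L (IsCMField.complexConj L) 3 (n + 4) T₀ μZ),
        ‖rightConvFun (↥(maximalRealSubfield L)) L (IsCMField.complexConj L) 3 νG (h j) ((f : HN (↥(maximalRealSubfield L)) L (IsCMField.complexConj L) 3 (n + 4) a μZ) : borelQuotient (↥(maximalRealSubfield L)) L (IsCMField.complexConj L) 3 → ℂ) z‖ ≤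
          C * ‖f‖ * ((borelQuotHeight (↥(maximalRealSubfield L)) L (IsCMField.complexConj L) 3 z : ℝ)) ^ (-(0 : ℝ)) := by
    intro j
    subst hfun
    exact K2E1TruncatedCuspDecayHK1CMThree.hK1_cm_three_of L μZ νG hβ hμZ (hη j) (n + 4) a T₀ hT₀pos
      (fun νN _ _ _ 𝓕N h𝓕 h0 htop f => K2E1TruncatedCuspConstantTermAEU2.ae_borelConstantTerm_indicator_comp_eq_zero_of_mem_HNcusp νG νN
        (fun _ hb₀ => map_conj_toAdelic_eq_self_three hc hc1 νN hb₀) h𝓕 h0 htop hβ hμZ (n + 4) a f)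
      (lt_of_lt_of_le zero_lt_one (hκ j)) (hκT j) (hΩ j) (m := 0) le_rfl
  choose C hC hK1' using hK1
  -- the high-part operators `K_j` ((O2c) ★ with `hid` ★), the low cut-off `A` ((O1) ★)
  have hK : ∀ j, ∃ K : HX (↥(maximalRealSubfield L)) L (IsCMField.complexConj L) 3 (n + 4) μ →L[ℂ] Lp ℂ 2 μ, ∀ u : HX (↥(maximalRealSubfield L)) L (IsCMField.complexConj L) 3 (n + 4) μ, ∀ᵐ x ∂μ,
      (supHeight (↥(maximalRealSubfield L)) L (IsCMField.complexConj L) 3 x ≤ T₀ → ((K u : Lp ℂ 2 μ) : (quasiSplit (↥(maximalRealSubfield L)) L (IsCMField.complexConj L) 3).automorphicQuotient → ℂ) x = 0) ∧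
      ∀ g : (quasiSplit (↥(maximalRealSubfield L)) L (IsCMField.complexConj L) 3).Adelic, (quasiSplit (↥(maximalRealSubfield L)) L (IsCMField.complexConj L) 3).toAutomorphicQuotient g⁻¹ = x → T₀ < borelHeight g →
        ((K u : Lp ℂ 2 μ) : (quasiSplit (↥(maximalRealSubfield L)) L (IsCMField.complexConj L) 3).automorphicQuotient → ℂ) x =
          (∫ y, h j y * (u : (quasiSplit (↥(maximalRealSubfield L)) L (IsCMField.complexConj L) 3).automorphicQuotient → ℂ) ((quasiSplit (↥(maximalRealSubfield L)) L (IsCMField.complexConj L) 3).toAutomorphicQuotient (g * y)⁻¹) ∂νG) -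
            borelConstantTerm ν 𝓕 (fun x' => ∫ y, h j y * (u : (quasiSplit (↥(maximalRealSubfield L)) L (IsCMField.complexConj L) 3).automorphicQuotient → ℂ) ((quasiSplit (↥(maximalRealSubfield L)) L (IsCMField.complexConj L) 3).toAutomorphicQuotient (x' * y)⁻¹) ∂νG) g := fun j =>
    exists_highPartOperator_three μ νG hβ hμZ hT₀1 hb (hs j) (hC j) le_rfl (hK1' j) le_rfl ν 𝓕
      fun u => hid_of_unfolding νG ν hconj h𝓕N h𝓕₀ h𝓕top hβ hμZ μ h𝓕c hb (hhc j) (hhs j) (lt_of_lt_of_le zero_lt_one (hκ j)) (hκT j) (hΩ j) (hs j) le_rfl u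
  choose K hKspec using hK
  obtain ⟨A, hA, -⟩ := exists_lowPart_clm (F := ↥(maximalRealSubfield L)) (E := L) (c := IsCMField.complexConj L) (N := 3) (n + 4) T₀ μ
  -- the height transforms `ĥ_j`: entire
  -- the family on `U ∖ P`, glued from the patches `V_j := U ∩ {ĥ_j ≠ 0}`
  refine ⟨T₀, hT₀1, exists_differentiableOn_of_local_ae_eq_within _ fun z₀ hz₀ => ?_⟩
  obtain ⟨j, hj⟩ := hcov z₀ (hUD hz₀.1)
  set V : Set ℂ := U ∩ {z : ℂ | (ŝ j z) ≠ 0} with hVdef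
  have hVo : IsOpen V := hUo.inter (isOpen_ne_fun (hŝ j).continuous continuous_const)
  have hz₀V : z₀ ∈ V := ⟨hz₀.1, hj⟩
  -- the natural payer on `D := V ∩ (U ∖ P)`
  have hEcinv : ∀ z ∈ V ∩ (U \ P), ∀ γ : (quasiSplit (↥(maximalRealSubfield L)) L (IsCMField.complexConj L) 3).arithmeticSubgroup, ∀ x : (quasiSplit (↥(maximalRealSubfield L)) L (IsCMField.complexConj L) 3).Adelic,
      Ec z ((γ : (quasiSplit (↥(maximalRealSubfield L)) L (IsCMField.complexConj L) 3).Adelic) * x) = Ec z x := by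
    intro z hz γ x
    rw [hE5 j z hz.1.1 hz.2.2 hz.1.2 ((γ : (quasiSplit (↥(maximalRealSubfield L)) L (IsCMField.complexConj L) 3).Adelic) * x), hE5 j z hz.1.1 hz.2.2 hz.1.2 x]
    congr 1
    refine integral_congr_ae (Eventually.of_forall fun y => ?_)
    show h j y * _ = h j y * _
    rw [mul_assoc, lift_quotientSubgroup_mul ((vX z : HX (↥(maximalRealSubfield L)) L (IsCMField.complexConj L) 3 (n + 4) μ) : (quasiSplit (↥(maximalRealSubfield L)) L (IsCMField.complexConj L) 3).automorphicQuotient → ℂ)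
      (γ : (quasiSplit (↥(maximalRealSubfield L)) L (IsCMField.complexConj L) 3).Adelic) ((quasiSplit (↥(maximalRealSubfield L)) L (IsCMField.complexConj L) 3).arithmeticSubgroup_le_quotientSubgroup γ.2) (x * y)]
  obtain ⟨Fam, hFd, hFam⟩ := exists_family_of_operator_letters_three' ν h𝓕N hT₀1 (n + 4) μ νG (h j) (D := V ∩ (U \ P)) vX (hvX.mono fun z hz => hz.1.1)
    (ŝ j) ((hŝ j).differentiableOn.mono (subset_univ _)) (fun z hz => hz.1.2)
    Ec hEcinv (fun z hz g => hE5 j z hz.1.1 hz.2.2 hz.1.2 g) (T j) (hTX j) A hA (K j) (hKspec j)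
  exact ⟨V, hVo.mem_nhds hz₀V, Fam, hFd, hFam⟩

/-- **CLOSER₃ (ŝ-currency) RESTRICTED TO ANY `D ⊆ U ∖ P`** — the per-ball patch consumed by the exports edition (`D = (U_n ∖ P) ∩ {Re ≤ 2}`, or a quarter-plane box of the (V) road):
`∃ T₀ ≥ 1, ∃ Fam, DifferentiableOn ℂ Fam D ∧ ∀ z ∈ D, ⇑(Fam z) =ᵐ[μ] quotFun (Λ^{T₀} (Ec z))`. [cite: BernsteinLapid2019, §4 Claims 4–5 (p. 10)] [cite: MoeglinWaldspurger1995, IV.2.3] -/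
theorem exists_truncatedFamily_cm_three_of_eigen_on
    (μ : Measure (quasiSplit (↥(maximalRealSubfield L)) L (IsCMField.complexConj L) 3).automorphicQuotient) [(quasiSplit (↥(maximalRealSubfield L)) L (IsCMField.complexConj L) 3).IsAutomorphicMeasure μ]
    (νG : Measure (quasiSplit (↥(maximalRealSubfield L)) L (IsCMField.complexConj L) 3).Adelic) [νG.IsHaarMeasure] [νG.IsInvInvariant] [SFinite νG]
    (ν : Measure ↥(adelicUnipotent (↥(maximalRealSubfield L)) L (IsCMField.complexConj L) 3)) [ν.IsHaarMeasure] [ν.IsMulRightInvariant] [ν.IsInvInvariant]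
    {𝓕 : Set ↥(adelicUnipotent (↥(maximalRealSubfield L)) L (IsCMField.complexConj L) 3)}
    (h𝓕N : IsFundamentalDomain ↥(rationalUnipotent (↥(maximalRealSubfield L)) L (IsCMField.complexConj L) 3) 𝓕 ν) (h𝓕c : IsCompact (closure 𝓕)) (h𝓕₀ : ν 𝓕 ≠ 0)
    {β : (quasiSplit (↥(maximalRealSubfield L)) L (IsCMField.complexConj L) 3).Adelic → ℝ≥0∞}
    (hβ : IsCoveringWeight ↥((arithmeticBorel (↥(maximalRealSubfield L)) L (IsCMField.complexConj L) 3).map (quasiSplit (↥(maximalRealSubfield L)) L (IsCMField.complexConj L) 3).arithmeticSubgroup.subtype) β)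
    {μZ : Measure (borelQuotient (↥(maximalRealSubfield L)) L (IsCMField.complexConj L) 3)} [SFinite μZ]
    (hμZ : ∀ f : borelQuotient (↥(maximalRealSubfield L)) L (IsCMField.complexConj L) 3 → ℝ≥0∞, Measurable f → ∫⁻ z, f z ∂μZ = ∫⁻ g, β g * f (toBorelQuotient (↥(maximalRealSubfield L)) L (IsCMField.complexConj L) 3 g) ∂νG)
    (n : ℕ) {I : Type} [Fintype I] (η : I → GL (Fin 3) (AdeleRing (𝓞 L) L) → ℝ) (h : I → (quasiSplit (↥(maximalRealSubfield L)) L (IsCMField.complexConj L) 3).Adelic → ℂ) (a : ℝ≥0) (κ : I → ℝ≥0)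
    (T : I → HX (↥(maximalRealSubfield L)) L (IsCMField.complexConj L) 3 (n + 4) μ →L[ℂ] HX (↥(maximalRealSubfield L)) L (IsCMField.complexConj L) 3 (n + 4) μ) (U : Set ℂ)
    (vX : ℂ → HX (↥(maximalRealSubfield L)) L (IsCMField.complexConj L) 3 (n + 4) μ)
    (ŝ : I → ℂ → ℂ) (hŝ : ∀ i, Differentiable ℂ (ŝ i))
    (hη : ∀ i, IsTestFunctionGL 3 L (η i))
    (hdef : ∀ i, h i = fun y : (quasiSplit (↥(maximalRealSubfield L)) L (IsCMField.complexConj L) 3).Adelic => orbitalSmoothing νG (fun x : (quasiSplit (↥(maximalRealSubfield L)) L (IsCMField.complexConj L) 3).Adelic => ((η i (adelicVal (↥(maximalRealSubfield L)) L (IsCMField.complexConj L) 3 ((StdForm.antidiagonal 3).over L) x) : ℝ) : ℂ)) (fun x : (quasiSplit (↥(maximalRealSubfield L)) L (IsCMField.complexConj L) 3).Adelic => ((η i (adelicVal (↥(maximalRealSubfield L)) L (IsCMField.complexConj L) 3 ((StdForm.antidiagonal 3).over L) x) : ℝ) : ℂ)) y)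
    (hreg : ∀ i, Continuous (h i) ∧ HasCompactSupport (h i))
    (hcov : ∀ z ∈ Metric.ball (0 : ℂ) (n + 2), ∃ i, (ŝ i z) ≠ 0)
    (ha : 0 < a) (hκ : ∀ i, 1 ≤ κ i)
    (hΩ : ∀ i, ∀ z : borelQuotient (↥(maximalRealSubfield L)) L (IsCMField.complexConj L) 3, ∀ y ∈ tsupport (h i), borelQuotHeight (↥(maximalRealSubfield L)) L (IsCMField.complexConj L) 3 z ≤ κ i * borelQuotHeight (↥(maximalRealSubfield L)) L (IsCMField.complexConj L) 3 (rightShift (↥(maximalRealSubfield L)) L (IsCMField.complexConj L) 3 y z))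
    (hTX : ∀ i, ∀ u : HX (↥(maximalRealSubfield L)) L (IsCMField.complexConj L) 3 (n + 4) μ, (T i u : (quasiSplit (↥(maximalRealSubfield L)) L (IsCMField.complexConj L) 3).automorphicQuotient → ℂ) =ᵐ[μ.withDensity fun x => (((supHeight (↥(maximalRealSubfield L)) L (IsCMField.complexConj L) 3 x)⁻¹ ^ (2 * (n + 4)) : ℝ≥0) : ℝ≥0∞)]
      fun ξ => ∫ y, h i y * (u : (quasiSplit (↥(maximalRealSubfield L)) L (IsCMField.complexConj L) 3).automorphicQuotient → ℂ) (y⁻¹ • ξ) ∂νG)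
    (hUo : IsOpen U) (hUD : U ⊆ Metric.ball (0 : ℂ) (n + 2)) (hvX : DifferentiableOn ℂ vX U)
    (Ec : ℂ → (quasiSplit (↥(maximalRealSubfield L)) L (IsCMField.complexConj L) 3).Adelic → ℂ) (P : Set ℂ)
    (hE5 : ∀ j, ∀ z ∈ U, z ∉ P → (ŝ j z) ≠ 0 → ∀ g : (quasiSplit (↥(maximalRealSubfield L)) L (IsCMField.complexConj L) 3).Adelic,
      Ec z g = (ŝ j z)⁻¹ *
        ∫ y, h j y * ((vX z : HX (↥(maximalRealSubfield L)) L (IsCMField.complexConj L) 3 (n + 4) μ) : (quasiSplit (↥(maximalRealSubfield L)) L (IsCMField.complexConj L) 3).automorphicQuotient → ℂ)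
          ((quasiSplit (↥(maximalRealSubfield L)) L (IsCMField.complexConj L) 3).toAutomorphicQuotient (g * y)⁻¹) ∂νG)
    {D : Set ℂ} (hD : D ⊆ U \ P) :
    ∃ T₀ : ℝ≥0, 1 ≤ T₀ ∧ ∃ Fam : ℂ → Lp ℂ 2 μ, DifferentiableOn ℂ Fam D ∧
      ∀ z ∈ D, ((Fam z : Lp ℂ 2 μ) : (quasiSplit (↥(maximalRealSubfield L)) L (IsCMField.complexConj L) 3).automorphicQuotient → ℂ) =ᵐ[μ]
        (quasiSplit (↥(maximalRealSubfield L)) L (IsCMField.complexConj L) 3).quotFun (truncation ν 𝓕 T₀ (Ec z)) := by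
  obtain ⟨T₀, hT₀, Fam, hFd, hFam⟩ := exists_truncatedFamily_cm_three_of_eigen L μ νG ν h𝓕N h𝓕c h𝓕₀ hβ hμZ n η h a κ T U vX ŝ hŝ hη hdef hreg hcov ha hκ hΩ hTX hUo hUD hvX Ec P hE5
  exact ⟨T₀, hT₀, Fam, hFd.mono hD, fun z hz => hFam z (hD hz)⟩

end Closer

end Summit.HodgeConjecture.HodgeConjecture.Cruxes.H413.K2E1ChiTruncatedFamilyCMThree

end
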